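import Summits.QuantumFields.BalabanUV.Beta.FP.RoadEndGeneric
import Summits.QuantumFields.BalabanUV.Beta.FP.WSlotSplit
import Summits.QuantumFields.BalabanUV.Beta.HessKerConvCKPlug

/-!
# `BalabanUV.Beta.FP.RoadEndLeft` — road «FP» for binder row D1, RULING R-FP-40 (A)∕(B) (owner, gen 10): THE ROAD's END AT THE PLACEMENT OF RECORD
# FOR THE LITERAL — UNDRESSED leg and columns `KPerf … m`, the jet data's OWN (dressed) stencils and tables — WITH THE K-SLOT OF THE WALL DISCHARGED
# BY NAME (gan24's `KSlotAssembly.convCKWall_holds`) AND THE W-SLOT SPLIT FOLDED IN; rows #16∕#18 of `RESIDUAL-FP.md` §10 need NO new mathematics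

HONEST DEPENDENCY (page 1, mandatory): continuum YM on T⁴ ⇐ BetaPertH ∧ nine spine estimates (0/9 proved); BetaPertH ⇐ (D1) ∧ (D4) ∧ CAP+tail;
G-an2-4 gates asym, D1 and NE2/3/4.  HONEST FRAMING (cell contract, verbatim): «discharging `BetaPertH` makes Bałaban's UV stability UNCONDITIONAL —
a real constructive-QFT result; it is NOT the continuum limit and NOT the Clay problem.»  THIS MODULE DISCHARGES NOTHING of the wall beyond what the
tree already proves: it is [folklore]∕[our object] COMPOSITION BY NAME of asym1's `HessKerFourFamily.d1Drift_iff_of_cauchy_self_unit`∕`TbalOf_apply`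
(the wall's member IS `hessKer K_j (vertexOfK K_j Lc (Js j).S) (Js j).W` BY DEFINITION — no dressing lemma), asym1's rate∕window merge
`HessKerConvCKPlug.exists_merged_rows`, gan24's THEOREM `KSlotAssembly.convCKWall_holds : 2 ≤ Lc → ConvCKWall 3 Lc` (the K-slot rows of (CONV-C) in the
adopted units), this lineage's `RoadEndGeneric.d1Drift_of_self_step_law_bounded` (gen 3) and `WSlotSplit.hessKer_add_W`∕`hasym_of_add_bounded` (gen 10).
What stays DISPLAYED: the S-∕W-slot rows of (CONV-C) for the jet data's OWN unit-rescaled stencils∕tables (row G-an2-4, NOT proved), the STEP LAW of the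
perfect coefficient family (shared crux STEP∕SDF), the W-slot decomposition with its `Loc`∕`MomentSummable` letters and the extra piece's bound (rows
(G8)∕(G-mix-W)), and (ASYMP) at the bi-vertex kernel — the LAST being LITERALLY the conclusion shape of the (LEDGER) skeleton's LEFT instance
(`FineHessianNearLedgerGen`∕`RoadAsympEndLeft`, leaf-01-g12) at `S m := SPerfOf … m`.  No `def`, no `def … : Prop`, nothing cited, 0 sorry; 0∕4 row-D1
binders; NOT (CONV-C) S∕W, NOT STEP, NOT (ASYMP), NOT D1, NOT BetaPertH, NOT continuum, NOT Clay.  «not in print; our bookkeeping».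

ABSOLUTE RULE (cell charter, verbatim): «No internally-minted statement may enter as a cited fact. Every hypothesis is either kernel-proved in this package or a
verbatim quotation of a PUBLISHED theorem with page reference. The manuscript(s) under audit are NOT citable for their own disputed steps — they are the thing
under adjudication; programme-internal (2001/route/tribunal) claims are never citable.»

WHY (R-FP-40 (A), `AXIAL-VS-SYM.md` v1.1).  `OneStepKernelFamily.TbalOf Lc Js j = hessKer (KInvStep Lc j) (vertexOfK (KInvStep Lc j) Lc (Js j).S) (Js j).W` for
EVERY literal `Js` (the (0.4) dressing of the literal of record `JsB12Sym` sits entirely in its jets).  Hence the perfect objects for the literal are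
`T^s_m := hessKer (KPerf m) (vertexOfK (KPerf m) (Lc^m) S^s_m) (WPerfOf … m)` with `S^s_m`, `WPerfOf … m` the unit-limits of the literal's OWN (j, m)
stencil∕table families — leg AND columns `KPerf m`, all of whose letters are landed.  Row #18 «WALL-SYM′» of `RESIDUAL-FP.md` §10 IS asym1's
`d1Drift_iff_of_cauchy_self_unit`; row #16's K-slot IS gan24's `convCKWall_holds`; this file records both BY NAME and hands the (LEDGER) skeleton its socket.

CONTENT.
* §1 [our object] `fPerfG_std_eq` — the generic perfect coefficient family at the STANDARD resolvent families `(j, m) ↦ KTot (Lc^(j+m)) (Lc^j)` IS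
  `m ↦ secondMoment (hessKer (KPerf m) (vertexOfK (KPerf m) (Lc^m) (SPerfOf S m)) (WPerfOf Wt m)) μ ν` (`rfl`: `KPerf_eq_KPerfOf`).
* §2 [folklore] **`hessKer_KPerf_add_W`**, **`hasym_left_of_wslot_split`** — the W-SPLIT row (R-FP-38) at the LEFT placement: leg `KPerf m` UNDRESSED
  (`WSlotSplit.hessKer_add_W` with `Spr (KPerf m)` from `exists_decays_KPerf_holds`; `hasym_of_add_bounded` verbatim).
* §3 [our object] **`d1Drift_iff_left_of_convCKWall`** — THE WALL ⟺ THE IDENTIFICATION AT THE LEFT PERFECT OBJECTS, K-SLOT GONE (`d = 3`, `2 ≤ Lc`, adopted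
  units `(sfStep Lc, smStep 3 Lc)`): for ANY `Js`, S-rows (rate `θ_S`, decay `δ_S > 0`) and W-rows (rate `θ_W`, decay `δ_W > 0`) of the jet data's OWN rescaled
  stencils∕tables ⟹ `D1Drift Lc Js N μ ν ↔ secondMoment (hessKer (KPerf 1) (vertexOfK (KPerf 1) Lc S∞) W∞) μ ν = stepBal N Lc`, `S∞ := limStOf (unitS_j (Js j).S)`,
  `W∞ := limTabOf (unitW_j (Js j).W)` — `KPerf_one` is `rfl`.
* §4 [our object] **`d1Drift_left_of_step_law_bounded`** — ROAD FP's END AT THE LEFT PLACEMENT, K-SLOT GONE: S-∕W-rows + STEP + (ASYMP) for the LEFT perfect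
  family `T^s_m` ⊢ `D1Drift Lc Js N μ ν` (`RoadEndGeneric.d1Drift_of_self_step_law_bounded` + the merge).
* §5 [our object] **`d1Drift_left_of_step_law_wslot_split`** — THE SAME WITH THE W-SLOT SPLIT FOLDED IN: (ASYMP) is asked ONLY of the bi-vertex kernel
  `hessKer (KPerf m) (vertexOfK (KPerf m) (Lc^m) (SPerfOf S m)) (vertex2OfK (KPerf m) (Lc^m) (Wf m))` (defect `Cg`) — the conclusion of
  `RoadAsympEndLeft.hasym_PiBF_of_sliceLedger_left` at `S m := SPerfOf … S m` — plus the split `WPerfOf Wt m = vertex2OfK (KPerf m) (Lc^m) (Wf m) + Wx m`,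
  its `Loc`∕`MomentSummable` letters and the bound `B` on the extra piece's second moment.

UPSHOT (numbers).  For the literal of record the by-type chain `D1Drift ⟸ …` now has, ABOVE the (LEDGER) skeleton, exactly these displayed classes:
(CONV-C) S-slot (2 binders) + W-slot (2 binders) + their 6 range letters; STEP (1); W-split (1 identity + 2 `Loc` + 2 `MomentSummable` + 1 bound); (ASYMP) at
the bi-vertex kernel (1) — and NO K-slot binder, NO dressing letter, NO sandwich hypothesis.
Provenance: road FP OWNER b2b-balaban-beta-d1-p3 gen 10 (prover-b2b-balaban-beta-d1-p3-g10-0), 2026-08-21, R-FP-40 (A)∕(B).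
-/

noncomputable section

namespace Summit.QuantumFields.BalabanUV.Beta.FP.RoadEndLeft

open Literature.MathematicalPhysics.QuantumFieldTheory.Balaban1983to89
open Literature.MathematicalPhysics.QuantumFieldTheory.Balaban1983to89.Beta
open Literature.MathematicalPhysics.QuantumFieldTheory.Balaban1983to89.B12Normalization (stepBal)
open ExpKernelCalculus (Site MKer Decays VertexFamily₂ tadpole hessKer)
open OneStepResolventKernel (Fib LocStencil JetData)
open OneStepKernelFamily (vertexOfK KInvStep TbalOf D1Drift)
open SecondOrderResponse (vertex2OfK)
open HessKerDressedLimit (limMKerOf limStOf limTabOf)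
open Summit.QuantumFields.BalabanUV.Beta.HessKerDressedUnits (unitK unitS unitW)
open Summit.QuantumFields.BalabanUV.Beta.HessKerFourFamily (d1Drift_iff_of_cauchy_self_unit)
open Summit.QuantumFields.BalabanUV.Beta.HessKerConvCKPlug (exists_merged_rows)
open Summit.QuantumFields.BalabanUV.Beta.TameKernelCalculus (Spr Loc)
open Summit.QuantumFields.BalabanUV.Beta.GAN24.CombesThomas (sfStep smStep sfStep_ne_zero smStep_ne_zero ConvCKWall)
open Summit.QuantumFields.BalabanUV.Beta.GAN24.KSlotAssembly (convCKWall_holds)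
open Summit.QuantumFields.BalabanUV.Beta.FP.PerfectObjects (KTot)
open Summit.QuantumFields.BalabanUV.Beta.FP.PerfectObjectsT (KPerf SPerfOf WPerfOf)
open Summit.QuantumFields.BalabanUV.Beta.FP.RoadEndGeneric (fPerfG d1Drift_of_self_step_law_bounded)
open Summit.QuantumFields.BalabanUV.Beta.FP.StepLawKHolds (exists_decays_KPerf_holds)
open Summit.QuantumFields.BalabanUV.Beta.FP.WSlotSplit (hessKer_add_W hasym_of_add_bounded)

/-! ## §1 The generic perfect coefficient family at the standard resolvent families IS the LEFT perfect family -/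

section Std

variable (Lc : ℕ) [NeZero Lc] (sf sm : ℕ → ℝ)
  (S : ℕ → ℕ → Fin (3 + 1) → (Fin (3 + 1) → ℤ) → MKer (3 + 1) (Fib 3))
  (Wt : ℕ → ℕ → Fin (3 + 1) → (Fin (3 + 1) → ℤ) → Fin (3 + 1) → (Fin (3 + 1) → ℤ) → MKer (3 + 1) (Fib 3))
  (μ ν : Fin 4)

/-- [our object] **THE GENERIC PERFECT COEFFICIENT FAMILY AT THE STANDARD (j, m)-RESOLVENTS IS THE LEFT PERFECT FAMILY**: with both resolvent families
`(j, m) ↦ KTot (Lc^(j+m)) (Lc^j)` (whose `m = 1` member is `KInvStep Lc j`, `PerfectObjects.KInvStep_eq_KTot`, `rfl`),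
`fPerfG … m = secondMoment (hessKer (KPerf m) (vertexOfK (KPerf m) (Lc^m) (SPerfOf S m)) (WPerfOf Wt m)) μ ν` — by `rfl` (`RoadEndGeneric.KPerf_eq_KPerfOf`). -/
theorem fPerfG_std_eq (m : ℕ) :
    fPerfG Lc sf sm (fun j m => KTot (d := 3) (Lc ^ (j + m)) (Lc ^ j)) (fun j m => KTot (d := 3) (Lc ^ (j + m)) (Lc ^ j)) S Wt μ ν m =
      B12Beta.secondMoment (hessKer (KPerf (d := 3) Lc sf sm m) (vertexOfK (KPerf (d := 3) Lc sf sm m) (Lc ^ m) (SPerfOf sf sm S m))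
        (WPerfOf sf sm Wt m)) μ ν := rfl

end Std

/-! ## §2 The W-slot split at the LEFT placement (leg `KPerf m` undressed) -/

section WSplit

variable {Lc : ℕ} [NeZero Lc]

/-- [folklore] **THE LEFT ONE-LOOP KERNEL IS ADDITIVE IN ITS W-SLOT** (`d = 3`, `2 ≤ Lc`, adopted units, `m ≥ 1`): for ANY vertex family `V` and bi-tables
whose `(μ,0;ν,z)` members are `Loc`, `hessKer (KPerf m) V (W₀ + W₁) μ ν z = hessKer (KPerf m) V W₀ μ ν z + ½·tadpole (KPerf m) (W₁ μ 0 ν z)`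
(`WSlotSplit.hessKer_add_W`; `Spr (KPerf m)` from `StepLawKHolds.exists_decays_KPerf_holds`). -/
theorem hessKer_KPerf_add_W (hLc : 2 ≤ Lc) {m : ℕ} (hm : 1 ≤ m) (V : Fin (3 + 1) → Site (3 + 1) → MKer (3 + 1) (Fib 3))
    {W₀ W₁ : Fin (3 + 1) → Site (3 + 1) → Fin (3 + 1) → Site (3 + 1) → MKer (3 + 1) (Fib 3)}
    (μ ν : Fin (3 + 1)) (z : Site (3 + 1)) (h₀ : Loc (W₀ μ 0 ν z)) (h₁ : Loc (W₁ μ 0 ν z)) :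
    hessKer (KPerf (d := 3) Lc (sfStep Lc) (smStep 3 Lc) m) V (W₀ + W₁) μ ν z =
      hessKer (KPerf (d := 3) Lc (sfStep Lc) (smStep 3 Lc) m) V W₀ μ ν z +
        (1 / 2 : ℝ) * tadpole (KPerf (d := 3) Lc (sfStep Lc) (smStep 3 Lc) m) (W₁ μ 0 ν z) := by
  obtain ⟨CK, δK, hδK, hK⟩ := exists_decays_KPerf_holds hLc hm
  have hA : Spr (KPerf (d := 3) Lc (sfStep Lc) (smStep 3 Lc) m) := ⟨_, δK, hδK, hK⟩
  exact hessKer_add_W hA V μ ν z h₀ h₁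

/-- [our object] **(ASYMP) FOR THE FULL SECOND-ORDER SLOT ⟸ (ASYMP) FOR THE `W₀`-KERNEL ∧ A BOUNDED EXTRA PIECE, LEFT PLACEMENT** (row (W-SPLIT) of R-FP-38
at the placement of record): leg `KPerf m` UNDRESSED, ANY first-order family `S m`, a slot split `Wt m = W₀ m + Wx m` (DISPLAYED), the `Loc` letters of the two
slots' `(μ,0;ν,z)` members, the `MomentSummable` letters of the two pieces, (ASYMP) for the `W₀`-kernel with defect `Cg`, and the bound `B` of the extra piece
`z ↦ ½·tadpole (KPerf m) (Wx m μ 0 ν z)` ⟹ (ASYMP) for the full slot with defect `Cg + B`.  The LEFT twin of `WSlotSplit.hasym_TPerfOf_of_wslot_split`. -/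
theorem hasym_left_of_wslot_split (hLc : 2 ≤ Lc)
    {S : ℕ → Fin (3 + 1) → (Fin (3 + 1) → ℤ) → MKer (3 + 1) (Fib 3)}
    {Wt W₀ Wx : ℕ → Fin (3 + 1) → (Fin (3 + 1) → ℤ) → Fin (3 + 1) → (Fin (3 + 1) → ℤ) → MKer (3 + 1) (Fib 3)}
    (hsplit : ∀ m : ℕ, 1 ≤ m → Wt m = W₀ m + Wx m)
    {μ ν : Fin (3 + 1)}
    (hloc₀ : ∀ m : ℕ, 1 ≤ m → ∀ z, Loc (W₀ m μ 0 ν z)) (hlocx : ∀ m : ℕ, 1 ≤ m → ∀ z, Loc (Wx m μ 0 ν z))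
    (hs₀ : ∀ m : ℕ, 1 ≤ m → B14DeltaBeta.MomentSummable
      (hessKer (KPerf (d := 3) Lc (sfStep Lc) (smStep 3 Lc) m) (vertexOfK (KPerf (d := 3) Lc (sfStep Lc) (smStep 3 Lc) m) (Lc ^ m) (S m)) (W₀ m)) μ ν)
    (hsx : ∀ m : ℕ, 1 ≤ m → B14DeltaBeta.MomentSummable
      (fun μ' ν' z => (1 / 2 : ℝ) * tadpole (KPerf (d := 3) Lc (sfStep Lc) (smStep 3 Lc) m) (Wx m μ' 0 ν' z)) μ ν)
    {s Cg B : ℝ}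
    (hasym₀ : ∀ m : ℕ, 1 ≤ m →
      |B12Beta.secondMoment (hessKer (KPerf (d := 3) Lc (sfStep Lc) (smStep 3 Lc) m)
          (vertexOfK (KPerf (d := 3) Lc (sfStep Lc) (smStep 3 Lc) m) (Lc ^ m) (S m)) (W₀ m)) μ ν - (m : ℝ) * s| ≤ Cg)
    (hextra : ∀ m : ℕ, 1 ≤ m →
      |B12Beta.secondMoment
          (fun μ' ν' z => (1 / 2 : ℝ) * tadpole (KPerf (d := 3) Lc (sfStep Lc) (smStep 3 Lc) m) (Wx m μ' 0 ν' z)) μ ν| ≤ B) :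
    ∀ m : ℕ, 1 ≤ m →
      |B12Beta.secondMoment (hessKer (KPerf (d := 3) Lc (sfStep Lc) (smStep 3 Lc) m)
          (vertexOfK (KPerf (d := 3) Lc (sfStep Lc) (smStep 3 Lc) m) (Lc ^ m) (S m)) (Wt m)) μ ν - (m : ℝ) * s| ≤ Cg + B := by
  refine hasym_of_add_bounded
    (T₀ := fun m => hessKer (KPerf (d := 3) Lc (sfStep Lc) (smStep 3 Lc) m)
      (vertexOfK (KPerf (d := 3) Lc (sfStep Lc) (smStep 3 Lc) m) (Lc ^ m) (S m)) (W₀ m))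
    (T₁ := fun m μ' ν' z => (1 / 2 : ℝ) * tadpole (KPerf (d := 3) Lc (sfStep Lc) (smStep 3 Lc) m) (Wx m μ' 0 ν' z))
    (fun m hm z => ?_) hs₀ hsx hasym₀ hextra
  rw [hsplit m hm]
  exact hessKer_KPerf_add_W hLc hm _ μ ν z (hloc₀ m hm z) (hlocx m hm z)

end WSplit

/-! ## §3 The wall ⟺ the identification at the LEFT perfect objects, K-slot gone -/

section Wall

variable {Lc : ℕ} [NeZero Lc] (Js : ℕ → JetData 3 Lc) {Cs cS δS θS Cw cW δW θW : ℝ}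

/-- [our object] **THE WALL ⟺ THE EXPLICIT IDENTIFICATION AT THE LEFT PERFECT OBJECTS, FOR ANY STEP JET DATA, THE K-SLOT DISCHARGED** (`d = 3`, `2 ≤ Lc`,
adopted units `(sfStep Lc, smStep 3 Lc)`).  DISPLAYED: the S-slot rows (`j`-uniform `LocStencil` of the jet data's OWN rescaled stencils + all-scales deviations,
rate `θ_S ∈ [0,1)`, decay `δ_S > 0`) and the W-slot rows (`VertexFamily₂`, rate `θ_W`, decay `δ_W > 0`) — row G-an2-4's S∕W slots, NOT proved here.  NOT
displayed: the K-slot rows — they are gan24's THEOREM `KSlotAssembly.convCKWall_holds`; the rate∕window merge is asym1's `HessKerConvCKPlug.exists_merged_rows`;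
the socket is asym1's `HessKerFourFamily.d1Drift_iff_of_cauchy_self_unit` (no dressing lemma: `TbalOf_apply` is `rfl`).  CONCLUSION:
`D1Drift Lc Js N μ ν ↔ secondMoment (hessKer (KPerf 1) (vertexOfK (KPerf 1) Lc S∞) W∞) μ ν = stepBal N Lc` with `S∞`, `W∞` the constructed unit-limits of the
jet data's own stencils∕tables (`KPerf_one` is `rfl`).  Row #18 «WALL-SYM′» of `RESIDUAL-FP.md` §10, BY NAME. -/
theorem d1Drift_iff_left_of_convCKWall (hLc : 2 ≤ Lc)
    (hS : ∀ j, LocStencil (unitS (sfStep Lc j) (smStep 3 Lc j) (Js j).S) Cs δS)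
    (hSall : ∀ k j, LocStencil (unitS (sfStep Lc (k + j)) (smStep 3 Lc (k + j)) (Js (k + j)).S -
      unitS (sfStep Lc k) (smStep 3 Lc k) (Js k).S) (cS * θS ^ k) δS)
    (hW : ∀ j, VertexFamily₂ (unitW (sfStep Lc j) (smStep 3 Lc j) (Js j).W) Lc Cw δW)
    (hWall : ∀ k j, VertexFamily₂ (unitW (sfStep Lc (k + j)) (smStep 3 Lc (k + j)) (Js (k + j)).W -
      unitW (sfStep Lc k) (smStep 3 Lc k) (Js k).W) Lc (cW * θW ^ k) δW)
    (hδS : 0 < δS) (hδW : 0 < δW) (hθS0 : 0 ≤ θS) (hθS1 : θS < 1) (hθW0 : 0 ≤ θW) (hθW1 : θW < 1) (μ ν : Fin 4) (N : ℝ) :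
    D1Drift Lc Js N μ ν ↔
      B12Beta.secondMoment (hessKer (KPerf (d := 3) Lc (sfStep Lc) (smStep 3 Lc) 1)
        (vertexOfK (KPerf (d := 3) Lc (sfStep Lc) (smStep 3 Lc) 1) Lc (limStOf fun j => unitS (sfStep Lc j) (smStep 3 Lc j) (Js j).S))
        (limTabOf fun j => unitW (sfStep Lc j) (smStep 3 Lc j) (Js j).W)) μ ν = stepBal N Lc := by
  obtain ⟨C, δK, cK, θ, R, hR, hRK, hRS, hRW, hθ0, hθ1, hK, hKall, hSall', hWall'⟩ :=
    exists_merged_rows (Lc := Lc) (convCKWall_holds hLc) (S := fun j => unitS (sfStep Lc j) (smStep 3 Lc j) (Js j).S)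
      (W := fun j => unitW (sfStep Lc j) (smStep 3 Lc j) (Js j).W) hSall hWall hδS hδW hθS0 hθS1 hθW0 hθW1
  exact d1Drift_iff_of_cauchy_self_unit Js (sfStep Lc) (smStep 3 Lc) sfStep_ne_zero smStep_ne_zero hK hKall hS hSall' hW hWall' hR
    (by linarith) hRS hRW hθ0 hθ1 μ ν N

end Wall

/-! ## §4 Road FP's END at the LEFT placement, K-slot gone -/

section End

variable {Lc : ℕ} [NeZero Lc] (Js : ℕ → JetData 3 Lc)
  (S : ℕ → ℕ → Fin (3 + 1) → (Fin (3 + 1) → ℤ) → MKer (3 + 1) (Fib 3))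
  (Wt : ℕ → ℕ → Fin (3 + 1) → (Fin (3 + 1) → ℤ) → Fin (3 + 1) → (Fin (3 + 1) → ℤ) → MKer (3 + 1) (Fib 3))
  {Cs cS δS θS Cw cW δW θW : ℝ}

/-- **ROAD «FP», THE END AT THE PLACEMENT OF RECORD, K-SLOT DISCHARGED (bounded-defect form)** [our object] (`d = 3`, `2 ≤ Lc`, adopted units).  For ANY step jet
data `Js` (any dressing, any root — in particular the literal of record) and ANY (j, m)-indexed stencil∕table families `(S, Wt)` whose `m = 1` members are the jet
data's own `((Js j).S, (Js j).W)`: IF the S-∕W-slot rows of (CONV-C) hold for the rescaled `m = 1` families (row G-an2-4; HYPOTHESES), AND the LEFT perfect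
coefficient family `f m := secondMoment (hessKer (KPerf m) (vertexOfK (KPerf m) (Lc^m) (SPerfOf S m)) (WPerfOf Wt m)) μ ν` (spelled `fPerfG` at the standard
resolvent families, §1) satisfies the STEP LAW `f (m+1) = f m + f 1` (shared crux STEP) and the LEADING-LOG ASYMPTOTICS `|f m − m·stepBal N Lc| ≤ Cg` ((ASYMP)),
THEN `D1Drift Lc Js N μ ν`.  The K-slot rows are gan24's `convCKWall_holds`, merged by asym1's `exists_merged_rows`; the END is this lineage's
`RoadEndGeneric.d1Drift_of_self_step_law_bounded`.  Discharges nothing else. -/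
theorem d1Drift_left_of_step_law_bounded (hLc : 2 ≤ Lc)
    (hS1 : ∀ j, S j 1 = (Js j).S) (hW1 : ∀ j, Wt j 1 = (Js j).W)
    (hS : ∀ j, LocStencil (unitS (sfStep Lc j) (smStep 3 Lc j) (Js j).S) Cs δS)
    (hSall : ∀ k j, LocStencil (unitS (sfStep Lc (k + j)) (smStep 3 Lc (k + j)) (Js (k + j)).S -
      unitS (sfStep Lc k) (smStep 3 Lc k) (Js k).S) (cS * θS ^ k) δS)
    (hW : ∀ j, VertexFamily₂ (unitW (sfStep Lc j) (smStep 3 Lc j) (Js j).W) Lc Cw δW)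
    (hWall : ∀ k j, VertexFamily₂ (unitW (sfStep Lc (k + j)) (smStep 3 Lc (k + j)) (Js (k + j)).W -
      unitW (sfStep Lc k) (smStep 3 Lc k) (Js k).W) Lc (cW * θW ^ k) δW)
    (hδS : 0 < δS) (hδW : 0 < δW) (hθS0 : 0 ≤ θS) (hθS1 : θS < 1) (hθW0 : 0 ≤ θW) (hθW1 : θW < 1) (μ ν : Fin 4) {N Cg : ℝ}
    (hstep : ∀ m : ℕ, 1 ≤ m →
      fPerfG Lc (sfStep Lc) (smStep 3 Lc) (fun j m => KTot (d := 3) (Lc ^ (j + m)) (Lc ^ j)) (fun j m => KTot (d := 3) (Lc ^ (j + m)) (Lc ^ j))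
          S Wt μ ν (m + 1) =
        fPerfG Lc (sfStep Lc) (smStep 3 Lc) (fun j m => KTot (d := 3) (Lc ^ (j + m)) (Lc ^ j)) (fun j m => KTot (d := 3) (Lc ^ (j + m)) (Lc ^ j))
            S Wt μ ν m +
          fPerfG Lc (sfStep Lc) (smStep 3 Lc) (fun j m => KTot (d := 3) (Lc ^ (j + m)) (Lc ^ j)) (fun j m => KTot (d := 3) (Lc ^ (j + m)) (Lc ^ j))
            S Wt μ ν 1)
    (hasym : ∀ m : ℕ, 1 ≤ m →
      |B12Beta.secondMoment (hessKer (KPerf (d := 3) Lc (sfStep Lc) (smStep 3 Lc) m)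
          (vertexOfK (KPerf (d := 3) Lc (sfStep Lc) (smStep 3 Lc) m) (Lc ^ m) (SPerfOf (sfStep Lc) (smStep 3 Lc) S m))
          (WPerfOf (sfStep Lc) (smStep 3 Lc) Wt m)) μ ν - (m : ℝ) * stepBal N Lc| ≤ Cg) :
    D1Drift Lc Js N μ ν := by
  obtain ⟨C, δK, cK, θ, R, hR, hRK, hRS, hRW, hθ0, hθ1, hK, hKall, hSall', hWall'⟩ :=
    exists_merged_rows (Lc := Lc) (convCKWall_holds hLc) (S := fun j => unitS (sfStep Lc j) (smStep 3 Lc j) (Js j).S)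
      (W := fun j => unitW (sfStep Lc j) (smStep 3 Lc j) (Js j).W) hSall hWall hδS hδW hθS0 hθS1 hθW0 hθW1
  exact d1Drift_of_self_step_law_bounded Js (sfStep Lc) (smStep 3 Lc) (fun j m => KTot (d := 3) (Lc ^ (j + m)) (Lc ^ j)) S Wt
    sfStep_ne_zero smStep_ne_zero (fun j => rfl) hS1 hW1 hK hKall hS hSall' hW hWall' hR (by linarith) hRS hRW hθ0 hθ1 μ ν hstep
    (fun m hm => by rw [fPerfG_std_eq]; exact hasym m hm)

/-! ## §5 … with the W-slot split folded in: (ASYMP) is asked of the bi-vertex kernel only -/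

/-- **ROAD «FP», THE END AT THE PLACEMENT OF RECORD WITH THE W-SLOT SPLIT, K-SLOT DISCHARGED** [our object] (`d = 3`, `2 ≤ Lc`, adopted units).  As
`d1Drift_left_of_step_law_bounded`, with (ASYMP) for the full slot REPLACED by: the DISPLAYED split of the perfect second-order slot
`WPerfOf Wt m = vertex2OfK (KPerf m) (Lc^m) (Wf m) + Wx m` (row #14: the bi-vertex part + the literal's response∕mixed∕`dM` summands in the limit), the `Loc`
letters of the two slots' `(μ,0;ν,z)` members, the `MomentSummable` letters of the two coarse pieces, the bound `B` of the extra piece's second moment (rows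
(G8)∕(G-mix-W)), and **(ASYMP) AT THE BI-VERTEX KERNEL** `|secondMoment (hessKer (KPerf m) (vertexOfK (KPerf m) (Lc^m) (SPerfOf S m)) (vertex2OfK (KPerf m) (Lc^m) (Wf m))) μ ν
− m·stepBal N Lc| ≤ Cg` — LITERALLY the conclusion of the (LEDGER) skeleton's LEFT instance `RoadAsympEndLeft.hasym_PiBF_of_sliceLedger_left` at
`S m := SPerfOf … S m` (its `∃ U ≥ 0, ∃ Cg'` unpacked into one constant).  CONCLUSION: `D1Drift Lc Js N μ ν`. -/
theorem d1Drift_left_of_step_law_wslot_split (hLc : 2 ≤ Lc)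
    (hS1 : ∀ j, S j 1 = (Js j).S) (hW1 : ∀ j, Wt j 1 = (Js j).W)
    (hS : ∀ j, LocStencil (unitS (sfStep Lc j) (smStep 3 Lc j) (Js j).S) Cs δS)
    (hSall : ∀ k j, LocStencil (unitS (sfStep Lc (k + j)) (smStep 3 Lc (k + j)) (Js (k + j)).S -
      unitS (sfStep Lc k) (smStep 3 Lc k) (Js k).S) (cS * θS ^ k) δS)
    (hW : ∀ j, VertexFamily₂ (unitW (sfStep Lc j) (smStep 3 Lc j) (Js j).W) Lc Cw δW)
    (hWall : ∀ k j, VertexFamily₂ (unitW (sfStep Lc (k + j)) (smStep 3 Lc (k + j)) (Js (k + j)).W -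
      unitW (sfStep Lc k) (smStep 3 Lc k) (Js k).W) Lc (cW * θW ^ k) δW)
    (hδS : 0 < δS) (hδW : 0 < δW) (hθS0 : 0 ≤ θS) (hθS1 : θS < 1) (hθW0 : 0 ≤ θW) (hθW1 : θW < 1) (μ ν : Fin 4) {N : ℝ}
    (hstep : ∀ m : ℕ, 1 ≤ m →
      fPerfG Lc (sfStep Lc) (smStep 3 Lc) (fun j m => KTot (d := 3) (Lc ^ (j + m)) (Lc ^ j)) (fun j m => KTot (d := 3) (Lc ^ (j + m)) (Lc ^ j))
          S Wt μ ν (m + 1) =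
        fPerfG Lc (sfStep Lc) (smStep 3 Lc) (fun j m => KTot (d := 3) (Lc ^ (j + m)) (Lc ^ j)) (fun j m => KTot (d := 3) (Lc ^ (j + m)) (Lc ^ j))
            S Wt μ ν m +
          fPerfG Lc (sfStep Lc) (smStep 3 Lc) (fun j m => KTot (d := 3) (Lc ^ (j + m)) (Lc ^ j)) (fun j m => KTot (d := 3) (Lc ^ (j + m)) (Lc ^ j))
            S Wt μ ν 1)
    -- the W-slot split of the perfect second-order slot (row #14), with its letters
    {Wf Wx : ℕ → Fin (3 + 1) → (Fin (3 + 1) → ℤ) → Fin (3 + 1) → (Fin (3 + 1) → ℤ) → MKer (3 + 1) (Fib 3)}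
    (hsplit : ∀ m : ℕ, 1 ≤ m →
      WPerfOf (sfStep Lc) (smStep 3 Lc) Wt m = vertex2OfK (KPerf (d := 3) Lc (sfStep Lc) (smStep 3 Lc) m) (Lc ^ m) (Wf m) + Wx m)
    (hloc₀ : ∀ m : ℕ, 1 ≤ m → ∀ z, Loc (vertex2OfK (KPerf (d := 3) Lc (sfStep Lc) (smStep 3 Lc) m) (Lc ^ m) (Wf m) μ 0 ν z))
    (hlocx : ∀ m : ℕ, 1 ≤ m → ∀ z, Loc (Wx m μ 0 ν z))
    (hs₀ : ∀ m : ℕ, 1 ≤ m → B14DeltaBeta.MomentSummable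
      (hessKer (KPerf (d := 3) Lc (sfStep Lc) (smStep 3 Lc) m)
        (vertexOfK (KPerf (d := 3) Lc (sfStep Lc) (smStep 3 Lc) m) (Lc ^ m) (SPerfOf (sfStep Lc) (smStep 3 Lc) S m))
        (vertex2OfK (KPerf (d := 3) Lc (sfStep Lc) (smStep 3 Lc) m) (Lc ^ m) (Wf m))) μ ν)
    (hsx : ∀ m : ℕ, 1 ≤ m → B14DeltaBeta.MomentSummable
      (fun μ' ν' z => (1 / 2 : ℝ) * tadpole (KPerf (d := 3) Lc (sfStep Lc) (smStep 3 Lc) m) (Wx m μ' 0 ν' z)) μ ν)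
    {Cg B : ℝ}
    -- (ASYMP) at the bi-vertex kernel (the (LEDGER) skeleton's LEFT conclusion) and the extra piece's bound
    (hasym₀ : ∀ m : ℕ, 1 ≤ m →
      |B12Beta.secondMoment (hessKer (KPerf (d := 3) Lc (sfStep Lc) (smStep 3 Lc) m)
          (vertexOfK (KPerf (d := 3) Lc (sfStep Lc) (smStep 3 Lc) m) (Lc ^ m) (SPerfOf (sfStep Lc) (smStep 3 Lc) S m))
          (vertex2OfK (KPerf (d := 3) Lc (sfStep Lc) (smStep 3 Lc) m) (Lc ^ m) (Wf m))) μ ν - (m : ℝ) * stepBal N Lc| ≤ Cg)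
    (hextra : ∀ m : ℕ, 1 ≤ m →
      |B12Beta.secondMoment
          (fun μ' ν' z => (1 / 2 : ℝ) * tadpole (KPerf (d := 3) Lc (sfStep Lc) (smStep 3 Lc) m) (Wx m μ' 0 ν' z)) μ ν| ≤ B) :
    D1Drift Lc Js N μ ν :=
  d1Drift_left_of_step_law_bounded Js S Wt hLc hS1 hW1 hS hSall hW hWall hδS hδW hθS0 hθS1 hθW0 hθW1 μ ν hstep
    (hasym_left_of_wslot_split hLc (S := fun m => SPerfOf (sfStep Lc) (smStep 3 Lc) S m)
      (Wt := fun m => WPerfOf (sfStep Lc) (smStep 3 Lc) Wt m)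
      (W₀ := fun m => vertex2OfK (KPerf (d := 3) Lc (sfStep Lc) (smStep 3 Lc) m) (Lc ^ m) (Wf m)) (Wx := Wx)
      hsplit hloc₀ hlocx hs₀ hsx hasym₀ hextra)

end End

end Summit.QuantumFields.BalabanUV.Beta.FP.RoadEndLeft

end
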